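import Summits.QuantumFields.YangMills.Theorems.LuscherReductionUpperTraceDoorBasics
import Summits.QuantumFields.YangMills.Theorems.TwistedTraceScaling.Negative.FixedLatticeTraceLawFalseWithoutThreshold
import HarnessLib

/-!
# `TwistedTraceScaling` (crux stmt-QuantumFields-20203, route `LuscherReduction`, skeleton «twolattice» rev 2):
# negative-side support VII-a — the dyadic trace ratio is MONOTONE in the number of steps; `r_𝔥(s) → 0` at `0⁺` and has no
# multiplicative period (refuter crux-disprover seat; this file does NOT refute the crux)

HONEST FRAMING: `TwistedTraceScaling` is a femto-rung (R2b1) crux of a CONDITIONAL reduction route; nothing here is a mass-gap or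
Clay statement.  All objects are the tree's (`TraceDoor.traceRatio`, `TraceDoor.levelMoment`, `TraceDoor.levelRatio`, `TraceDoor.xval`,
`TraceDoor.hTraceRatio`, `levelGap`); no proposition is defined under `Summits/`.  These are the two analytic tools of the clock-rigidity
file `…Negative.ClockRigidity` (support VII-b), split off for the 400-line rule; both are also POSITIVE tools for provers of the lane.

Sorry-free content (standard axioms only):

* §1 `r_𝔥(s) → 0` as `s → 0⁺`, quantitatively (`hTraceRatio_lt_of_small`: `Z_𝔥(s) ≥ (N+1)e^{−sΔ_N}` from the first `N+1` levels,
  `card_mul_exp_le_tsum_exp_levelGap`, and `r_𝔥 ≤ 1/Z_𝔥`, `hTraceRatio_le_inv`); hence ★ `r_𝔥` has NO multiplicative period: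
  `(∀ s>0, r_𝔥(θ s) = r_𝔥(s)) → θ = 1` (`hTraceRatio_scale_rigid`; iterate `μ = θ^{∓1} < 1` towards `0⁺` against `r_𝔥(1) > 0`).
* §2 ★ `traceRatio_mono`: `1 ≤ β → 2 ≤ T ≤ T' → r(L, β, T) ≤ r(L, β, T')` on every lattice — more Euclidean time never resurrects
  states.  Mechanism: the level moments `m(T) = Σ_k x_k^T` (`x_k = λ_k/λ_0 ∈ [0,1]`, summable for `T ≥ 2` by the closed child
  `TraceFormula`) are LOG-CONVEX, `m(n+1)² ≤ m(n)m(n+2)` (`levelMoment_succ_sq_le`, Cauchy–Schwarz on partial sums, then the `tsum`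
  limit), so `ρ(n) = m(n+1)/m(n)` is non-decreasing (`levelMoment_ratio_mono`) and
  `r(T+1)/r(T) = ρ(2T)ρ(2T+1)/ρ(T)² ≥ 1` in LEVEL currency (`levelRatio_le_succ`); TRACE = LEVEL currency for `β ≥ 1`, `T ≥ 2`
  (`Base.traceRatio_eq_levelRatio`).  Use: every two-sided femto estimate becomes one-sided estimates at neighbouring clocks
  (sandwiching `⌈·⌉` effects, comparing `femtoSteps (2s)` with `2·femtoSteps s`, a slower clock with the crux's, …).
-/

set_option autoImplicit false

noncomputable section

open MeasureTheory Filter Topology Real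
open Literature.MathematicalPhysics.QuantumFieldTheory hiding SU2
open Literature.MathematicalPhysics.QuantumLattice
open Literature.Analysis.OperatorTheory.YMMatrixModel
open scoped BigOperators

namespace Summit.QuantumFields.YangMills.Theorems.TwistedTraceScaling.Negative

open Summit.QuantumFields.YangMills.Theorems.FemtoTransferGap
open Summit.QuantumFields.YangMills.Theorems.FemtoTransferGap.TraceDoor
open Summit.QuantumFields.YangMills.Theorems.FemtoTransferGap.TT
open Summit.QuantumFields.YangMills.Theorems.FemtoTransferGap.TwoLattice

/-! ## §1 `r_𝔥(s) → 0` as `s → 0⁺`; `r_𝔥` has no multiplicative period -/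

/-- `Z_𝔥(s) ≥ (N+1)·e^{−sΔ_N}`: each of the first `N+1` terms dominates `e^{−sΔ_N}` (`Δ` is monotone). [folklore] -/
theorem card_mul_exp_le_tsum_exp_levelGap {s : ℝ} (hs : 0 < s) (N : ℕ) :
    ((N : ℝ) + 1) * Real.exp (-s * levelGap N) ≤ ∑' k, Real.exp (-s * levelGap k) := by
  have h1 : ∑ k ∈ Finset.range (N + 1), Real.exp (-s * levelGap k) ≤ ∑' k, Real.exp (-s * levelGap k) :=
    (LGS.levelGapSummable_all s hs).sum_le_tsum (Finset.range (N + 1)) (fun k _ => (Real.exp_pos _).le)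
  have h2 : ∑ _k ∈ Finset.range (N + 1), Real.exp (-s * levelGap N) ≤
      ∑ k ∈ Finset.range (N + 1), Real.exp (-s * levelGap k) :=
    Finset.sum_le_sum fun k hk => Real.exp_le_exp.mpr
      (mul_le_mul_of_nonpos_left (levelGap_mono (Nat.lt_succ_iff.mp (Finset.mem_range.mp hk))) (by linarith))
  rw [Finset.sum_const, Finset.card_range, nsmul_eq_mul] at h2
  push_cast at h2
  linarith

/-- **`r_𝔥(s) → 0` as `s → 0⁺`**, quantitatively: for every `c > 0` there is `s₀ > 0` with `r_𝔥(s) < c` for all `s ∈ (0, s₀]`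
(`r_𝔥 ≤ 1/Z_𝔥` and `Z_𝔥(s) ≥ (N+1)e^{−sΔ_N}` with `N+1 > 2/c`, `e^{−sΔ_N} ≥ 1/2`). [folklore] -/
theorem hTraceRatio_lt_of_small {c : ℝ} (hc : 0 < c) :
    ∃ s₀ : ℝ, 0 < s₀ ∧ ∀ s : ℝ, 0 < s → s ≤ s₀ → hTraceRatio s < c := by
  obtain ⟨N, hN⟩ : ∃ N : ℕ, 2 / c < (N : ℝ) + 1 := ⟨⌈2 / c⌉₊, (Nat.le_ceil _).trans_lt (lt_add_one _)⟩
  have hΔ : 0 ≤ levelGap N := levelGap_nonneg N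
  refine ⟨Real.log 2 / (levelGap N + 1), div_pos (Real.log_pos one_lt_two) (by linarith), fun s hs hs0 => ?_⟩
  have hZ := card_mul_exp_le_tsum_exp_levelGap hs N
  have hexp : 1 / 2 ≤ Real.exp (-s * levelGap N) := by
    have h1 : s * levelGap N ≤ Real.log 2 :=
      calc s * levelGap N ≤ s * (levelGap N + 1) := by nlinarith
        _ ≤ Real.log 2 / (levelGap N + 1) * (levelGap N + 1) := mul_le_mul_of_nonneg_right hs0 (by linarith)
        _ = Real.log 2 := div_mul_cancel₀ _ (by linarith)
    calc (1 : ℝ) / 2 = Real.exp (-Real.log 2) := by rw [Real.exp_neg, Real.exp_log two_pos, one_div]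
      _ ≤ Real.exp (-s * levelGap N) := Real.exp_le_exp.mpr (by linarith)
  have h3 : 1 / c < ((N : ℝ) + 1) / 2 := by
    rw [lt_div_iff₀ two_pos]
    calc 1 / c * 2 = 2 / c := by ring
      _ < (N : ℝ) + 1 := hN
  have h4 : ((N : ℝ) + 1) / 2 ≤ ((N : ℝ) + 1) * Real.exp (-s * levelGap N) := by
    rw [div_eq_mul_one_div]
    exact mul_le_mul_of_nonneg_left hexp (by positivity)
  have hZc : 1 / c < ∑' k, Real.exp (-s * levelGap k) := by linarith
  calc hTraceRatio s ≤ 1 / ∑' k, Real.exp (-s * levelGap k) := hTraceRatio_le_inv hs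
    _ < c := (one_div_lt (tsum_exp_levelGap_pos hs) hc).mpr hZc

/-- ★ **`r_𝔥` has no multiplicative period**: `r_𝔥(θ s) = r_𝔥(s)` for all `s > 0` forces `θ = 1` (iterate `μ = θ^{∓1} < 1`
towards `0⁺`, where `r_𝔥 → 0`, against `r_𝔥(1) > 0`). [folklore] -/
theorem hTraceRatio_scale_rigid {θ : ℝ} (hθ : 0 < θ) (h : ∀ s : ℝ, 0 < s → hTraceRatio (θ * s) = hTraceRatio s) :
    θ = 1 := by
  by_contra hθ1
  obtain ⟨μ, hμ0, hμ1, hμ⟩ : ∃ μ : ℝ, 0 < μ ∧ μ < 1 ∧ ∀ s : ℝ, 0 < s → hTraceRatio (μ * s) = hTraceRatio s := by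
    rcases lt_or_gt_of_ne hθ1 with h1 | h1
    · exact ⟨θ, hθ, h1, h⟩
    · refine ⟨θ⁻¹, inv_pos.mpr hθ, inv_lt_one_of_one_lt₀ h1, fun s hs => ?_⟩
      have h2 := h (θ⁻¹ * s) (by positivity)
      rw [← mul_assoc, mul_inv_cancel₀ hθ.ne', one_mul] at h2
      exact h2.symm
  have hiter : ∀ n : ℕ, hTraceRatio (μ ^ n) = hTraceRatio 1 := by
    intro n
    induction n with
    | zero => rw [pow_zero]
    | succ n ih => rw [pow_succ', hμ _ (pow_pos hμ0 n), ih]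
  obtain ⟨s₀, hs₀, hsmall⟩ := hTraceRatio_lt_of_small (hTraceRatio_pos one_pos)
  obtain ⟨n, hn⟩ := exists_pow_lt_of_lt_one hs₀ hμ1
  have h3 := hsmall (μ ^ n) (pow_pos hμ0 n) hn.le
  rw [hiter n] at h3
  exact lt_irrefl _ h3

/-! ## §2 The dyadic trace ratio is non-decreasing in the number of steps (`β ≥ 1`, `T ≥ 2`) -/

/-- `m(L, β, T) = Σ_k x_k^T` with `x_k = xval L β k` (definitional). [folklore] -/
theorem levelMoment_eq_tsum_xval (L : ℕ) [NeZero L] (β : ℝ) (T : ℕ) :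
    levelMoment L β T = ∑' k, xval L β k ^ T := rfl

/-- `1 ≤ m(T)` for `β ≥ 1`, `T ≥ 2` (the term `k = 0` is `x_0^T = 1`). [folklore] -/
theorem one_le_levelMoment (L : ℕ) [NeZero L] {β : ℝ} (hβ : 1 ≤ β) {T : ℕ} (hT : 2 ≤ T) : 1 ≤ levelMoment L β T := by
  have h := (Base.summable_xpow L hβ hT).le_tsum 0 (fun j _ => pow_nonneg (UTD.xval_nonneg hβ j) T)
  rw [div_self (levelValue_zero_su2Rep_pos L β).ne', one_pow] at h
  exact h

/-- `0 < m(T)` for `β ≥ 1`, `T ≥ 2`. [folklore] -/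
theorem levelMoment_pos (L : ℕ) [NeZero L] {β : ℝ} (hβ : 1 ≤ β) {T : ℕ} (hT : 2 ≤ T) : 0 < levelMoment L β T :=
  zero_lt_one.trans_le (one_le_levelMoment L hβ hT)

/-- **Log-convexity of the level moments**: `m(n+1)² ≤ m(n)·m(n+2)` for `β ≥ 1`, `n ≥ 2` — Cauchy–Schwarz on the partial sums with
`f_k = √(x_k^n)`, `g_k = √(x_k^{n+2})`, `f_k g_k = x_k^{n+1}`, then pass to the `tsum` limits. [folklore] -/
theorem levelMoment_succ_sq_le (L : ℕ) [NeZero L] {β : ℝ} (hβ : 1 ≤ β) {n : ℕ} (hn : 2 ≤ n) :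
    levelMoment L β (n + 1) ^ 2 ≤ levelMoment L β n * levelMoment L β (n + 2) := by
  have hx0 : ∀ k, 0 ≤ xval L β k := fun k => UTD.xval_nonneg hβ k
  have hlim : ∀ p : ℕ, 2 ≤ p →
      Tendsto (fun M : ℕ => ∑ k ∈ Finset.range M, xval L β k ^ p) atTop (𝓝 (levelMoment L β p)) :=
    fun p hp => (Base.summable_xpow L hβ hp).hasSum.tendsto_sum_nat
  have hfin : ∀ M : ℕ, (∑ k ∈ Finset.range M, xval L β k ^ (n + 1)) ^ 2 ≤
      (∑ k ∈ Finset.range M, xval L β k ^ n) * ∑ k ∈ Finset.range M, xval L β k ^ (n + 2) := by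
    intro M
    have h := Finset.sum_mul_sq_le_sq_mul_sq (Finset.range M) (fun k => Real.sqrt (xval L β k ^ n))
      (fun k => Real.sqrt (xval L β k ^ (n + 2)))
    have e1 : ∀ k, Real.sqrt (xval L β k ^ n) * Real.sqrt (xval L β k ^ (n + 2)) = xval L β k ^ (n + 1) := by
      intro k
      rw [← Real.sqrt_mul (pow_nonneg (hx0 k) n), ← pow_add, show n + (n + 2) = 2 * (n + 1) by ring, pow_mul',
        Real.sqrt_sq (pow_nonneg (hx0 k) _)]
    have e2 : ∀ (k p : ℕ), Real.sqrt (xval L β k ^ p) ^ 2 = xval L β k ^ p := fun k p => Real.sq_sqrt (pow_nonneg (hx0 k) p)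
    simp only [e1, e2] at h
    exact h
  exact le_of_tendsto_of_tendsto' ((hlim (n + 1) (by omega)).pow 2) ((hlim n hn).mul (hlim (n + 2) (by omega))) hfin

/-- The successive-moment ratio `ρ(n) = m(n+1)/m(n)` is non-decreasing on `n ≥ 2` (`β ≥ 1`). [folklore] -/
theorem levelMoment_ratio_mono (L : ℕ) [NeZero L] {β : ℝ} (hβ : 1 ≤ β) {j k : ℕ} (hj : 2 ≤ j) (hjk : j ≤ k) :
    levelMoment L β (j + 1) / levelMoment L β j ≤ levelMoment L β (k + 1) / levelMoment L β k := by
  induction k, hjk using Nat.le_induction with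
  | base => exact le_rfl
  | succ k hk ih =>
    refine ih.trans ?_
    have hk2 : 2 ≤ k := hj.trans hk
    have h0 := levelMoment_pos L hβ hk2
    have h1 := levelMoment_pos L hβ (by omega : 2 ≤ k + 1)
    have h2 := levelMoment_succ_sq_le L hβ hk2
    rw [show k + 2 = k + 1 + 1 from rfl] at h2
    rw [div_le_div_iff₀ h0 h1]
    nlinarith [h2]

/-- `r(T) ≤ r(T+1)` in LEVEL currency (`β ≥ 1`, `T ≥ 2`): `m(2T+2)/m(2T) = ρ(2T)ρ(2T+1) ≥ ρ(T)² = (m(T+1)/m(T))²`. [folklore] -/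
theorem levelRatio_le_succ (L : ℕ) [NeZero L] {β : ℝ} (hβ : 1 ≤ β) {T : ℕ} (hT : 2 ≤ T) :
    levelRatio L β T ≤ levelRatio L β (T + 1) := by
  unfold levelRatio
  have hmT := levelMoment_pos L hβ hT
  have hmT1 := levelMoment_pos L hβ (by omega : 2 ≤ T + 1)
  have hm2T := levelMoment_pos L hβ (by omega : 2 ≤ 2 * T)
  have hm2T1 := levelMoment_pos L hβ (by omega : 2 ≤ 2 * T + 1)
  have hρ1 := levelMoment_ratio_mono L hβ hT (by omega : T ≤ 2 * T)
  have hρ2 := levelMoment_ratio_mono L hβ hT (by omega : T ≤ 2 * T + 1)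
  rw [div_le_div_iff₀ hmT hm2T] at hρ1
  rw [div_le_div_iff₀ hmT hm2T1] at hρ2
  rw [show 2 * (T + 1) = 2 * T + 1 + 1 by ring, div_le_div_iff₀ (pow_pos hmT 2) (pow_pos hmT1 2)]
  have key := mul_le_mul hρ1 hρ2 (by positivity) (by positivity)
  exact le_of_mul_le_mul_left (by nlinarith [key]) hm2T1

/-- ★ **The dyadic trace ratio is non-decreasing in the number of steps**: `2 ≤ T ≤ T' → r(L, β, T) ≤ r(L, β, T')` for `β ≥ 1`
(more Euclidean time kills more states; log-convexity of `T ↦ m(T)`, TRACE = LEVEL currency by `TraceFormula`). [folklore] -/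
theorem traceRatio_mono (L : ℕ) [NeZero L] {β : ℝ} (hβ : 1 ≤ β) {T T' : ℕ} (hT : 2 ≤ T) (hTT' : T ≤ T') :
    traceRatio L β T ≤ traceRatio L β T' := by
  induction T', hTT' using Nat.le_induction with
  | base => exact le_rfl
  | succ k hk ih =>
    refine ih.trans ?_
    rw [Base.traceRatio_eq_levelRatio L hβ (hT.trans hk), Base.traceRatio_eq_levelRatio L hβ (by omega)]
    exact levelRatio_le_succ L hβ (hT.trans hk)

end Summit.QuantumFields.YangMills.Theorems.TwistedTraceScaling.Negative

end
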